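import Mathlib
import Literature.NumberTheory.LFunctions.WeilGroundEnergyParitySplit
import Literature.NumberTheory.LFunctions.WeilOddGroundState
import Summits.RiemannHypothesis.RiemannHypothesis.Theorems.SoloBlindWeilPoincare

/-!
# Mean-zero coercivity of the truncated Weil form forces an even ground state

Solo-blind residency (`solo-RiemannHypothesis-blind`, session s5): the kernel shape of the
"free sample at the origin" principle behind Theorem K of `paper/step1-parity.md` §10.

If the truncated Weil form `Re Q(g)` (`Q = weilQuadratic`) is bounded below by `B · ∫ |g|²` on the
tests of the window `[-a, a]` that have **mean zero** (`∫ g = 0`), and some **even** test of the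
window has Rayleigh quotient `< B`, then the even-sector ground energy lies strictly below the
odd-sector one: `ε_ev(a) < B ≤ ε_od(a)` — every odd test has mean zero.  On paper the mean-zero
coercivity is supplied, under RH and for `a ≤ π/d`, by the Kadec-¼ theorem applied to the sampling
set `{0} ∪ {±γ}` rescaled by a step `d` with `|γ(n) - n d| ≤ d/4` (the origin is a free sample point
because `∫ g = ĝ(0)`), with the explicit constant `B = (2π/d)(cos πδ - sin πδ)²`; that analytic input
is NOT formalised here — it enters as the hypothesis `hB`.  What is recorded is the purely
order-theoretic step from the two inequalities to the parity conclusion, over the tree's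
`weilEvenGroundEnergy` / `weilOddGroundEnergy`.
-/

noncomputable section

open Complex Filter Set MeasureTheory
open scoped Real Topology ComplexConjugate

namespace Summit.RiemannHypothesis.RiemannHypothesis.Theorems

open Literature.NumberTheory.LFunctions

/-- An odd function `ℝ → ℂ` has integral zero (Lebesgue measure is even; no integrability needed:
for a non-integrable `g` both sides are the junk value `0`). [folklore] -/
theorem soloBlind_integral_eq_zero_of_odd {g : ℝ → ℂ} (hodd : ∀ t, g (-t) = -g t) :
    ∫ t : ℝ, g t = 0 := by
  have h1 : ∫ t : ℝ, g (-t) = ∫ t : ℝ, g t := integral_neg_eq_self g volume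
  have h2 : ∫ t : ℝ, g (-t) = -∫ t : ℝ, g t := by
    simp_rw [hodd]
    exact integral_neg g
  have h3 : (∫ t : ℝ, g t) + ∫ t : ℝ, g t = 0 := by
    linear_combination h1.symm.trans h2
  exact add_self_eq_zero.1 h3

/-- **Mean-zero coercivity forces parity.**  If `B · ∫|g|² ≤ Re Q(g)` for every test `g` of the
window `[-a, a]` with `∫ g = 0`, and some even test `g₀ ≠ 0` of the window has
`Re Q(g₀) < B · ∫|g₀|²`, then `ε_ev(a) < B ≤ ε_od(a)`.  (Odd tests have mean zero, so the
coercivity bounds the odd sphere from below; the even witness bounds `ε_ev(a)` from above.) -/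
theorem soloBlind_parity_of_meanZero_coercive {a B : ℝ} (ha : 0 < a)
    (hB : ∀ g : ℝ → ℂ, IsWeilTest g → tsupport g ⊆ Icc (-a) a → ∫ t : ℝ, g t = 0 →
      B * ∫ t : ℝ, ‖g t‖ ^ 2 ≤ (weilQuadratic g).re)
    {g₀ : ℝ → ℂ} (hg₀ : IsWeilTest g₀) (hs₀ : tsupport g₀ ⊆ Icc (-a) a)
    (hev₀ : ∀ t, g₀ (-t) = g₀ t) (hpos : 0 < ∫ t : ℝ, ‖g₀ t‖ ^ 2)
    (hlt : (weilQuadratic g₀).re < B * ∫ t : ℝ, ‖g₀ t‖ ^ 2) :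
    weilEvenGroundEnergy a < B ∧ B ≤ weilOddGroundEnergy a := by
  refine ⟨?_, ?_⟩
  · have h1 := soloBlind_weilEvenGroundEnergy_le_div hg₀ hs₀ hev₀ hpos
    exact h1.trans_lt ((div_lt_iff₀ hpos).2 hlt)
  · refine le_weilOddGroundEnergy_of_forall ha fun g hg hs hodd hn ↦ ?_
    have h := hB g hg hs (soloBlind_integral_eq_zero_of_odd hodd)
    simpa [hn] using h

/-- Corollary: under the same two hypotheses the ground state of the window, when it is simple and
of definite parity, is even: `ε_ev(a) < ε_od(a)`. -/
theorem soloBlind_weilEven_lt_odd_of_meanZero_coercive {a B : ℝ} (ha : 0 < a)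
    (hB : ∀ g : ℝ → ℂ, IsWeilTest g → tsupport g ⊆ Icc (-a) a → ∫ t : ℝ, g t = 0 →
      B * ∫ t : ℝ, ‖g t‖ ^ 2 ≤ (weilQuadratic g).re)
    {g₀ : ℝ → ℂ} (hg₀ : IsWeilTest g₀) (hs₀ : tsupport g₀ ⊆ Icc (-a) a)
    (hev₀ : ∀ t, g₀ (-t) = g₀ t) (hpos : 0 < ∫ t : ℝ, ‖g₀ t‖ ^ 2)
    (hlt : (weilQuadratic g₀).re < B * ∫ t : ℝ, ‖g₀ t‖ ^ 2) :
    weilEvenGroundEnergy a < weilOddGroundEnergy a :=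
  let h := soloBlind_parity_of_meanZero_coercive ha hB hg₀ hs₀ hev₀ hpos hlt
  h.1.trans_le h.2

/-- **Monotone form in the window.**  Mean-zero coercivity at level `B` on a window `[-a, a]`
bounds the odd energy of every SMALLER window `0 < b ≤ a` from below as well (a test of the
smaller window is a test of the larger one), so one coercivity estimate at `a = π/d` serves every
`b ≤ π/d`; the even witness must then be exhibited window by window. -/
theorem soloBlind_le_weilOddGroundEnergy_of_meanZero_coercive {a b B : ℝ} (hb : 0 < b)
    (hba : b ≤ a)
    (hB : ∀ g : ℝ → ℂ, IsWeilTest g → tsupport g ⊆ Icc (-a) a → ∫ t : ℝ, g t = 0 →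
      B * ∫ t : ℝ, ‖g t‖ ^ 2 ≤ (weilQuadratic g).re) :
    B ≤ weilOddGroundEnergy b := by
  refine le_weilOddGroundEnergy_of_forall hb fun g hg hs hodd hn ↦ ?_
  have hs' : tsupport g ⊆ Icc (-a) a := hs.trans (Icc_subset_Icc (neg_le_neg hba) hba)
  have h := hB g hg hs' (soloBlind_integral_eq_zero_of_odd hodd)
  simpa [hn] using h

end Summit.RiemannHypothesis.RiemannHypothesis.Theorems

end
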